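import Literature.Probability.RandomPlanarGeometry.SLETraceGeneralBM
import Literature.Probability.RandomPlanarGeometry.CritPercSLESimplePathProofs
import HarnessLib

/-!
# The simple phase `κ ≤ 4` of chordal SLE, for every Brownian motion

Topic `Probability/RandomPlanarGeometry`; proved theorems only (no definition, no named fact).
Rohde–Schramm (2005), Thm. 6.1 / Lawler (2005), Prop. 6.8–6.9 in the form needed on a **general**
probability space: for every real Brownian motion `B` with continuous paths vanishing at time `0`
and every `0 < κ ≤ 4`, almost surely the chordal Loewner chain of `√κ B` is generated by a curve
`γ` which is a **simple trace** — injective, with `γ(t) ∈ ℍ` for `t > 0`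
(`ae_isSimpleTrace_of_isBrownianReal`).

The tree proves everything on the canonical space: non-swallowing of real points
`sle_swallowingTime_ofReal_eq_top_holds` (Lawler Prop. 6.8 (i)) and the deterministic conclusion
`Loewner.IsGeneratedByCurve.isSimpleTrace_of_shift`. We transport the non-swallowing event (a
measurable path event, `Loewner.measurableSet_lt_swallowingTime`) along the identity in law
between `√κ B` and the canonical driving function (`map_eq_map_sleDriving_of_isPreBrownianReal`)
— across probability spaces (`Loewner.ae_forall_swallowingTime_eq_top_of_identDistrib'`) — apply
it to the Markov shifts `B(s + ·) - B(s)` and their reflections (Mathlib `IsBrownianReal.shift`,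
`IsBrownianReal.neg`), and conclude with generation by a curve for a general Brownian motion
(`ae_isGeneratedByCurve_of_isBrownianReal`). Needed by the whole-plane theory: the radial pieces of
whole-plane SLE_κ(ρ), `κ ≤ 4`, pulled back by the Schramm–Wilson change, must not touch the unit
circle.

## References

* S. Rohde, O. Schramm, *Basic properties of SLE*, Ann. of Math. 161 (2005), Thm. 6.1, Lemma 6.2.
  [RohdeSchramm2005]
* G. F. Lawler, *Conformally Invariant Processes in the Plane*, AMS (2005), Prop. 6.8, Prop. 6.9.
  [Lawler2005]
-/

noncomputable section

open Set Filter Topology MeasureTheory ProbabilityTheory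
open scoped NNReal

namespace Literature.Probability.RandomPlanarGeometry

namespace Loewner

/-- **Law transfer for the non-swallowing event, across probability spaces**: if two families of
continuous driving paths started at `0`, on possibly different probability spaces, are identically
distributed as random paths and a.s. the first swallows no positive real point, then so does the
second (the proof of `ae_forall_swallowingTime_eq_top_of_identDistrib`, verbatim, for two
spaces). [folklore] -/
theorem ae_forall_swallowingTime_eq_top_of_identDistrib' {Ω₁ Ω₂ : Type*} [MeasurableSpace Ω₁]
    [MeasurableSpace Ω₂] {P₁ : Measure Ω₁} {P₂ : Measure Ω₂} {W₁ : Ω₁ → ℝ≥0 → ℝ} {W₂ : Ω₂ → ℝ≥0 → ℝ}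
    (hc₁ : ∀ ω, Continuous (W₁ ω)) (hc₂ : ∀ ω, Continuous (W₂ ω)) (h0₁ : ∀ ω, W₁ ω 0 = 0)
    (h0₂ : ∀ ω, W₂ ω 0 = 0) (hid : IdentDistrib W₁ W₂ P₁ P₂)
    (h : ∀ᵐ ω ∂P₁, ∀ x : ℝ, 0 < x → swallowingTime (W₁ ω) x = ⊤) :
    ∀ᵐ ω ∂P₂, ∀ x : ℝ, 0 < x → swallowingTime (W₂ ω) x = ⊤ := by
  -- the regularised path, recentred at time `0`
  set R : (ℝ≥0 → ℝ) → ℝ≥0 → ℝ := fun w u ↦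
    Process.pathRegularize w u - Process.pathRegularize w 0 with hR
  have hRc : ∀ w, Continuous (R w) := fun w ↦
    (Process.continuous_pathRegularize w).sub continuous_const
  have hR0 : ∀ w, R w 0 = 0 := fun w ↦ sub_self _
  have hRm : ∀ u, Measurable fun w ↦ R w u := fun u ↦
    (Process.measurable_pathRegularize u).sub (Process.measurable_pathRegularize 0)
  have hRid : ∀ w : ℝ≥0 → ℝ, Continuous w → w 0 = 0 → R w = w := by
    intro w hw hw0
    ext u
    simp [hR, Process.pathRegularize_eq_self_of_continuous hw, hw0]
  -- the test points `xₙ = 1/(n+1)` and the path-space event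
  set xs : ℕ → ℝ := fun n ↦ 1 / ((n : ℝ) + 1) with hxs
  have hxs_pos : ∀ n, 0 < xs n := fun n ↦ by rw [hxs]; positivity
  set S : Set (ℝ≥0 → ℝ) := {w | ∀ n m : ℕ,
    ((m : ℝ≥0) : WithTop ℝ≥0) < swallowingTime (R w) (xs n : ℂ)} with hS
  have hSm : MeasurableSet S := by
    have hS' : S = ⋂ n : ℕ, ⋂ m : ℕ,
        {w | ((m : ℝ≥0) : WithTop ℝ≥0) < swallowingTime (R w) (xs n : ℂ)} := by
      ext w
      simp only [hS, mem_setOf_eq, mem_iInter]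
    rw [hS']
    exact MeasurableSet.iInter fun n ↦ MeasurableSet.iInter fun m ↦
      measurableSet_lt_swallowingTime (W := R) (t := (m : ℝ≥0)) hRc hR0 (fun u _ ↦ hRm u)
        (hxs_pos n)
  -- for continuous paths from `0`, membership in `S` is the target property
  have hiff : ∀ w : ℝ≥0 → ℝ, Continuous w → w 0 = 0 →
      (w ∈ S ↔ ∀ x : ℝ, 0 < x → swallowingTime w x = ⊤) := by
    intro w hw hw0
    simp only [hS, mem_setOf_eq, hRid w hw hw0]
    constructor
    · intro hw' x hx
      obtain ⟨n, hn⟩ := exists_nat_one_div_lt hx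
      have hn' : xs n ≤ x := by rw [hxs]; exact hn.le
      have hle : swallowingTime w (xs n : ℂ) ≤ swallowingTime w x :=
        swallowingTime_mono_right hw (by rw [hw0]; exact hxs_pos n) hn'
      refine WithTop.eq_top_iff_forall_gt.2 fun r ↦ ?_
      obtain ⟨m, hm⟩ := exists_nat_gt r
      calc (r : WithTop ℝ≥0) < (m : ℝ≥0) := by exact_mod_cast hm
        _ < swallowingTime w (xs n : ℂ) := hw' n m
        _ ≤ swallowingTime w x := hle
    · intro hw' n m
      rw [hw' _ (hxs_pos n)]
      exact WithTop.coe_lt_top _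
  -- transfer through the identity in law
  have hm₁ : ∀ᵐ ω ∂P₁, W₁ ω ∈ S := by
    filter_upwards [h] with ω hω
    exact (hiff _ (hc₁ ω) (h0₁ ω)).2 hω
  have hm₂ : ∀ᵐ ω ∂P₂, W₂ ω ∈ S := by
    have h1 : P₁ (W₁ ⁻¹' Sᶜ) = 0 := ae_iff.1 hm₁
    have h2 : P₂ (W₂ ⁻¹' Sᶜ) = 0 := by
      rw [← hid.measure_mem_eq hSm.compl]
      exact h1
    exact ae_iff.2 h2
  filter_upwards [hm₂] with ω hω
  exact (hiff _ (hc₂ ω) (h0₂ ω)).1 hω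

end Loewner

variable {Ω : Type*} {mΩ : MeasurableSpace Ω} {P : Measure Ω} {B : ℝ≥0 → Ω → ℝ} {κ : ℝ≥0}

/-- **No positive real point is swallowed (`κ ≤ 4`), for every Brownian motion**: for a real
Brownian motion `B` with continuous paths, `B₀ = 0`, and `κ ≤ 4`, almost surely
`T_x(√κ B) = ∞` for all `x > 0` (Lawler (2005), Prop. 6.8 (i) on the canonical space,
`sle_swallowingTime_ofReal_eq_top_holds`, transported in law). [cite: Lawler2005, Prop. 6.8] -/
theorem ae_forall_swallowingTime_eq_top_of_isBrownianReal [IsProbabilityMeasure P] (hB : IsBrownianReal B P)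
    (hBm : ∀ t, Measurable (B t)) (hBc : ∀ ω, Continuous (B · ω)) (hB0 : ∀ ω, B 0 ω = 0) (hκ4 : κ ≤ 4) :
    ∀ᵐ ω ∂P, ∀ x : ℝ, 0 < x → Loewner.swallowingTime (fun u ↦ Real.sqrt κ * B u ω) x = ⊤ := by
  have hlaw := map_eq_map_sleDriving_of_isPreBrownianReal hB.toIsPreBrownianReal hBm κ
  have hid : IdentDistrib (fun ω ↦ sleDriving κ ω) (fun ω (u : ℝ≥0) ↦ Real.sqrt κ * B u ω)
      Process.preWienerMeasure P :=
    ⟨(measurable_sleDriving_pi κ).aemeasurable,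
      (measurable_pi_lambda _ fun t ↦ (hBm t).const_mul _).aemeasurable, hlaw.symm⟩
  exact Loewner.ae_forall_swallowingTime_eq_top_of_identDistrib' (continuous_sleDriving κ)
    (fun ω ↦ continuous_const.mul (hBc ω)) (sleDriving_zero κ) (fun ω ↦ by simp [hB0 ω]) hid
    (sle_swallowingTime_ofReal_eq_top_holds hκ4)

/-- **No real point but the tip is swallowed by the Markov-shifted chain (`κ ≤ 4`)**, for every
Brownian motion: almost surely, for every `x ≠ 0`, `T_x(√κ (B(s + ·) - B(s))) = ∞` (Markov shift
and reflection of Brownian motion, Mathlib `IsBrownianReal.shift` / `.neg`).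
[cite: RohdeSchramm2005, proof of Thm 6.1] -/
theorem ae_forall_swallowingTime_shift_eq_top_of_isBrownianReal [IsProbabilityMeasure P]
    (hB : IsBrownianReal B P) (hBm : ∀ t, Measurable (B t)) (hBc : ∀ ω, Continuous (B · ω))
    (hκ4 : κ ≤ 4) (s : ℝ≥0) :
    ∀ᵐ ω ∂P, ∀ x : ℝ, x ≠ 0 →
      Loewner.swallowingTime (fun u ↦ Real.sqrt κ * (B (s + u) ω - B s ω)) x = ⊤ := by
  set Bs : ℝ≥0 → Ω → ℝ := fun t ω ↦ B (s + t) ω - B s ω with hBsdef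
  have hBs : IsBrownianReal Bs P := hB.shift s
  have hBsm : ∀ t, Measurable (Bs t) := fun t ↦ (hBm _).sub (hBm _)
  have hBsc : ∀ ω, Continuous (Bs · ω) := fun ω ↦
    ((hBc ω).comp (continuous_const.add continuous_id)).sub continuous_const
  have hBs0 : ∀ ω, Bs 0 ω = 0 := fun ω ↦ by simp [hBsdef]
  have hpos := ae_forall_swallowingTime_eq_top_of_isBrownianReal hBs hBsm hBsc hBs0 hκ4
  have hneg := ae_forall_swallowingTime_eq_top_of_isBrownianReal hBs.neg
    (fun t ↦ (hBsm t).neg) (fun ω ↦ (hBsc ω).neg) (fun ω ↦ by simp [hBs0 ω]) hκ4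
  filter_upwards [hpos, hneg] with ω h1 h2 x hx
  rcases lt_or_gt_of_ne hx with hx' | hx'
  · have h3 := h2 (-x) (neg_pos.2 hx')
    have heq : (fun u ↦ Real.sqrt κ * (-Bs) u ω) = fun u ↦ -(Real.sqrt κ * Bs u ω) := by
      funext u; simp [mul_neg]
    rw [heq, Loewner.swallowingTime_neg_ofReal] at h3
    exact h3
  · exact h1 x hx'

/-- **Rohde–Schramm (2005), Thm. 6.1, for every Brownian motion**: for a real Brownian motion `B`
with continuous paths, `B₀ = 0`, measurable marginals, and `0 < κ ≤ 4`, almost surely the chordal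
Loewner chain of `√κ B` is generated by a curve which is a simple trace (injective, in `ℍ` for
positive times): generation by `ae_isGeneratedByCurve_of_isBrownianReal` (`κ ≠ 8`), non-swallowing
of real points from every rational time (`ae_forall_swallowingTime_shift_eq_top_of_isBrownianReal`,
re-centred by `Loewner.swallowingTime_add_const`), and the deterministic
`Loewner.IsGeneratedByCurve.isSimpleTrace_of_shift`. [cite: RohdeSchramm2005, Thm 6.1] -/
theorem ae_isSimpleTrace_of_isBrownianReal [IsProbabilityMeasure P] (hB : IsBrownianReal B P)
    (hBm : ∀ t, Measurable (B t)) (hBc : ∀ ω, Continuous (B · ω)) (hκ : 0 < κ) (hκ4 : κ ≤ 4) :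
    ∀ᵐ ω ∂P, ∃ γ : ℝ≥0 → ℂ, Loewner.IsGeneratedByCurve (fun s ↦ Real.sqrt κ * B s ω) γ ∧
      Loewner.IsSimpleTrace γ := by
  have hκ8 : κ ≠ 8 := by
    intro h; rw [h] at hκ4; norm_num at hκ4
  have hgen := ae_isGeneratedByCurve_of_isBrownianReal hB hBc hκ.ne' hκ8
  have hreal : ∀ᵐ ω ∂P, ∀ q : ℚ, 0 < q → ∀ x : ℝ,
      x ≠ Real.sqrt κ * B ((q : ℝ).toNNReal) ω →
        Loewner.swallowingTime (fun u ↦ Real.sqrt κ * B ((q : ℝ).toNNReal + u) ω) x = ⊤ := by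
    rw [ae_all_iff]
    intro q
    filter_upwards [ae_forall_swallowingTime_shift_eq_top_of_isBrownianReal hB hBm hBc hκ4
      ((q : ℝ).toNNReal)] with ω hω _ x hx
    set c : ℝ := Real.sqrt κ * B ((q : ℝ).toNNReal) ω with hc
    have h1 := hω (x - c) (sub_ne_zero.2 hx)
    have key := Loewner.swallowingTime_add_const
      (fun u ↦ Real.sqrt κ * (B ((q : ℝ).toNNReal + u) ω - B ((q : ℝ).toNNReal) ω)) ((x - c : ℝ) : ℂ) c
    have hfun : (fun u ↦ Real.sqrt κ * (B ((q : ℝ).toNNReal + u) ω - B ((q : ℝ).toNNReal) ω) + c) =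
        fun u ↦ Real.sqrt κ * B ((q : ℝ).toNNReal + u) ω := by
      funext u; rw [hc]; ring
    rw [hfun, h1] at key
    have hxc : (((x - c : ℝ) : ℂ) + (c : ℂ)) = (x : ℂ) := by push_cast; ring
    rw [hxc] at key
    exact key
  filter_upwards [hgen, hreal] with ω ⟨γ, hγ⟩ h2
  have hW : Continuous fun s ↦ Real.sqrt κ * B s ω := continuous_const.mul (hBc ω)
  exact ⟨γ, hγ, hγ.isSimpleTrace_of_shift hW fun q hq t ↦ hγ.apply_add_mem_domain_or_eq hW (h2 q hq) t⟩

end Literature.Probability.RandomPlanarGeometry
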